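import Summits.QuantumFields.BalabanUV.T4Continuum.Support.BlockAveragePushDirSplit
import Summits.QuantumFields.BalabanUV.T4Continuum.Support.AveragingDeficitPushForwardLinear
import Summits.QuantumFields.BalabanUV.T4Continuum.Support.AveragingDeficitPlaqLin
import HarnessLib

/-!
# T⁴ programme, node NE3, row S6-Y7 (P3 leaf L7 «SLOP», k-level input (K3)) — THE LINEARISED DOUBLE-BAR AVERAGE AT A CURVED
# SMALL-FIELD BACKGROUND: `dbarLin = (transported straight segments) + O(w)`, hence `‖dbarLin‖_{sup→sup} ≤ L + C·w` and
# `‖dbarLin‖_{ℓ¹→ℓ¹} ≤ L^{1−d} + C·w` on the torus (`BlockAverageDbarLinBound`)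

Cell `pub-balaban`, NE3 formalisation swarm (`t4/formal/NE3/LEAVES.md` row S5∕S6, sub-row S6-Y7; unit
`b2b-balaban-t4-ne3-formalise-leaf-10`, gen 2); sequel of `BlockAveragePushDirSplit` (the split `pushDir = gaugeDir (cavg W)
(frameLin ∘ L·) + dbarLin` and its flat sanity `dbarLin 1 = L·Q₀`).  THIS FILE proves the two SHARP ONE-STEP OPERATOR BOUNDS of
the non-gauge part `dbarLin` at a CURVED `U(N)` background all of whose loop variables `W_{c,x}` are within `w ≤ 1∕32` of `1`
(the small-field regime of B7 p. 25, tree `B7Prop2Explicit.norm_Wcx_sub_one_le`: `w = 16(d+1)(d+4)L²a`):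
§1 the linearised transport along the loop `Γ_{c,x} ∪ (−Γ_c)` splits EXACTLY into tree ∕ transported straight segment ∕
transported reversed translated tree ∕ transported reversed `Γ_c` (`dhol_loopWord`, tree `dhol_append`∕`dhol_revWord`); hence
§2 `dbarLin L W Y c = Ad_{V̄(c)⁻¹} S(c) + E(c)` with the MAIN TERM `S(c) = Σ_{x∈B(c₋)} L^{−d} Ad_{W(Γ_{c₋,x})}(δ_Y W)([x, x+Le_κ])`
(B7's `Σ_x L^{−d}(R_{0,c₋}Y)([x, x(c)])`, (125)) and an ERROR `‖E(c)‖ ≤ w·(1250·(ℓ_loops + ℓ_Γ) + 8·ℓ_trees′ + 2·ℓ_Γ)` in the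
local `ℓ¹` weights of `Y` (`norm_dbarLin_sub_main_le`; inputs BY NAME: row NE3-R2's `norm_sideDeriv_sub_lin_le` (1250·w),
`norm_Ad_sub_le`, `norm_dhol_le`, `norm_Xavg_le`); §3 the SUP bound `‖dbarLin c‖ ≤ (L + Csup(d,L)·w)·s` for `‖Y‖ ≤ s` near `c`;
§4 the `ℓ¹` bound on the torus `Σ_{y∈[0,M)^d} Σ_κ ‖dbarLin (L·y, κ)‖ ≤ (L∕L^d + Cl1(d,L)·w)·‖Y‖_{ℓ¹([0,LM)^d)}` — the
CONTRACTION `L^{1−d} + O(a)` of localised directions announced in SHAPE `Statements/S6-Y7-SHAPE-v1.md` §2′ (K3), with the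
multiplicity of the contour neighbourhoods from `AveragingDeficitPeriodicCounting.sum_periodBox_box_le`.

HONEST FRAMING: finite-`T⁴` kinematics of ONE block-averaging step on ONE lattice (rung (B)+1 — NOT infinite volume, NOT a
mass gap, NOT Clay); linear estimates at one background; nothing of NE3 is claimed (NE3-E stays CONDITIONAL on the co-owners'
⟨named structures⟩; the k-level L7(a) stays OPEN ∕ road P3's typed binder — (K4)–(K6) of the SHAPE are not here); no
`BetaPertH`, no (B), no G-an2-4; no printed sentence is a hypothesis ([cite:] tags are context).  PLACEMENT (human rule
2026-08-19): our work, under `Summits/QuantumFields/BalabanUV/`.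
-/

set_option autoImplicit false

open scoped BigOperators Matrix.Norms.L2Operator Topology
open NormedSpace Finset Filter Metric

namespace Summit.QuantumFields.BalabanUV.T4Continuum.BlockAverageDbarLinBound

open Literature.MathematicalPhysics.QuantumFieldTheory.Balaban1983to89
open B7Prop1Explicit B7Prop2Explicit MatrixLog UnitaryModel
open T4AveragingDeficitWall hiding Site Plane Plaq Bond
open T4AveragingDeficitWallBoundary (periodBox blockSites_periodBox sum_blocks_eq sum_periodBox_shift)
open T4AveragingDeficitNonAbelian (Ad_mul Ad_sub)
open AveragingDeficitPeriodicCounting (IsPeriodicDir)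
open AveragingDeficitTransport (dhol dhol_nil dhol_cons dstep lnorm lnorm_nil lnorm_cons norm_dhol_le dhol_append
  norm_Ad_of_unitary)
open AveragingDeficitTransportCalc (dhol_revWord)
open AveragingDeficitNearIdentity (norm_Ad_sub_le Ad_add Ad_sum Ad_smul Ad_neg Ad_one)
open AveragingDeficitSideDeriv (jexp loopWord mlogDeriv XavgDeriv sideDeriv sideDerivLin loopAvg norm_sideDeriv_sub_lin_le
  norm_Xavg_le Xavg_mem_skewAdjoint expUnit_Xavg_mem_unitary)
open AveragingDeficitResidualPairing (pushDir)
open BlockAveragePushDirSplit (frameLin dbarLin)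

noncomputable section

variable {d : ℕ} {n : Type*} [Fintype n] [DecidableEq n]

/-! ## §1 The linearised transport along the loop of (42), split along its four pieces -/

/-- **THE LOOP SPLITS**: `δ(Γ_{c,x} ∪ (−Γ_c)) = δ(tree) + Ad_{W(tree)} δ([x, x+Le_κ]) − Ad_{W_{c,x}·W(Γ_c)} δ(tree′) − Ad_{W_{c,x}} δ(Γ_c)`,
where `tree = Γ_{c₋,x}`, `tree′ = Γ_{c₊,x+Le_κ}` (the translated tree read from `c₊`) and `W_{c,x} = W(Γ_{c,x})W(Γ_c)⁻¹`
(tree `dhol_append`, `dhol_revWord`). [folklore] -/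
theorem dhol_loopWord (L : ℕ) (W : Site d → Fin d → (Matrix n n ℂ)ˣ) (Y : Site d → Fin d → Matrix n n ℂ) (q : Site d) (κ : Fin d)
    (x : Site d) :
    dhol W Y q (loopWord L κ x)
      = dhol W Y q (treeWord x) + Ad (hol W q (treeWord x)) (dhol W Y (q + x) (seg κ L))
        - Ad (Wcx L W q κ x * hol W q (seg κ L)) (dhol W Y (q + (L : ℤ) • e κ) (treeWord x))
        - Ad (Wcx L W q κ x) (dhol W Y q (seg κ L)) := by
  -- the closing piece `seg κ (−L)` read from `c₊` is the reversed `Γ_c`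
  have hclose : dhol W Y (q + (L : ℤ) • e κ) (seg κ (-(L : ℤ)))
      = -Ad (hol W q (seg κ L))⁻¹ (dhol W Y q (seg κ L)) := by
    have h := dhol_revWord W Y q (seg κ (L : ℤ))
    rw [disp_seg, revWord_seg] at h
    exact h
  -- the reversed translated tree read from `c₊ + x`
  have hrev : dhol W Y (q + (L : ℤ) • e κ + x) (revWord (treeWord x))
      = -Ad (hol W (q + (L : ℤ) • e κ) (treeWord x))⁻¹ (dhol W Y (q + (L : ℤ) • e κ) (treeWord x)) := by
    have h := dhol_revWord W Y (q + (L : ℤ) • e κ) (treeWord x)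
    rw [disp_treeWord] at h
    exact h
  -- `W(Γ_{c,x}) = W_{c,x} · W(Γ_c)`
  have hgamma : hol W q (gammaWord L κ x) = Wcx L W q κ x * hol W q (seg κ L) := by
    rw [Wcx, inv_mul_cancel_right]
  -- `W(tree ++ seg) · W(tree′)⁻¹ = W(Γ_{c,x})`
  have hts : hol W q (treeWord x ++ seg κ L) * (hol W (q + (L : ℤ) • e κ) (treeWord x))⁻¹ = hol W q (gammaWord L κ x) := by
    rw [gammaWord, hol_append W q (treeWord x ++ seg κ L), disp_append, disp_treeWord, disp_seg,
      hol_revWord' W (x := q + (L : ℤ) • e κ) _ _ (by rw [disp_treeWord]; abel)]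
  -- step A: loop = Γ_{c,x} ++ (−Γ_c)
  have hA : dhol W Y q (loopWord L κ x)
      = dhol W Y q (gammaWord L κ x) - Ad (Wcx L W q κ x) (dhol W Y q (seg κ L)) := by
    rw [loopWord, dhol_append, disp_gammaWord, hclose, Ad_neg, ← Ad_mul, ← Wcx, ← sub_eq_add_neg]
  -- step B: Γ_{c,x} = (tree ++ seg) ++ (−tree′)
  have hB : dhol W Y q (gammaWord L κ x)
      = dhol W Y q (treeWord x) + Ad (hol W q (treeWord x)) (dhol W Y (q + x) (seg κ L))
        - Ad (Wcx L W q κ x * hol W q (seg κ L)) (dhol W Y (q + (L : ℤ) • e κ) (treeWord x)) := by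
    rw [gammaWord, dhol_append, dhol_append, disp_append, disp_treeWord, disp_seg,
      show q + (x + (L : ℤ) • e κ) = q + (L : ℤ) • e κ + x by abel, hrev, Ad_neg, ← Ad_mul, hts, hgamma,
      ← sub_eq_add_neg]
  rw [hA, hB]

/-! ## §2 `dbarLin` = transported straight segments + `O(w)` -/

/-- THE MAIN TERM of the linearised double-bar average: the block average of the TRANSPORTED straight segments,
`S(c) = Σ_{x∈B(c₋)} L^{−d} Ad_{W(Γ_{c₋,x})} (δ_Y W)([x, x + Le_κ])` (B7 (125): `Σ_x L^{−(d+1)} (R_{0,c₋}A)([x, x(c)])`, times `L`).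
[cite: Balaban1985Averaging, (125) p.36] -/
def segMain (L : ℕ) (W : Site d → Fin d → (Matrix n n ℂ)ˣ) (Y : Site d → Fin d → Matrix n n ℂ) (q : Site d) (κ : Fin d) :
    Matrix n n ℂ :=
  ∑ r : Fin d → Fin L, (((L : ℝ) ^ d)⁻¹) • Ad (hol W q (treeWord (boxVec L r))) (dhol W Y (q + boxVec L r) (seg κ L))

/-- The local `ℓ¹` weight of the loops: `Σ_x L^{−d} Σ_{b ⊂ Γ_{c,x} ∪ (−Γ_c)} ‖Y(b)‖`. [folklore] -/
def loopL1 (L : ℕ) (Y : Site d → Fin d → Matrix n n ℂ) (q : Site d) (κ : Fin d) : ℝ :=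
  ∑ r : Fin d → Fin L, ((L : ℝ) ^ d)⁻¹ * lnorm Y q (loopWord L κ (boxVec L r))

/-- The local `ℓ¹` weight of the translated trees read from `c₊`: `Σ_x L^{−d} Σ_{b ⊂ Γ_{c₊,x}} ‖Y(b)‖`. [folklore] -/
def treeL1' (L : ℕ) (Y : Site d → Fin d → Matrix n n ℂ) (q : Site d) (κ : Fin d) : ℝ :=
  ∑ r : Fin d → Fin L, ((L : ℝ) ^ d)⁻¹ * lnorm Y (q + (L : ℤ) • e κ) (treeWord (boxVec L r))

/-- The local `ℓ¹` weight of the straight segments: `Σ_x L^{−d} Σ_{b ⊂ [x, x+Le_κ]} ‖Y(b)‖`. [folklore] -/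
def segL1 (L : ℕ) (Y : Site d → Fin d → Matrix n n ℂ) (q : Site d) (κ : Fin d) : ℝ :=
  ∑ r : Fin d → Fin L, ((L : ℝ) ^ d)⁻¹ * lnorm Y (q + boxVec L r) (seg κ L)

/-- `lnorm ≥ 0`. [folklore] -/
theorem lnorm_nonneg (Y : Site d → Fin d → Matrix n n ℂ) : ∀ (x : Site d) (w : List (Letter d)), 0 ≤ lnorm Y x w
  | x, [] => by simp
  | x, l :: w => by rw [lnorm_cons]; exact add_nonneg (norm_nonneg _) (lnorm_nonneg Y _ w)

/-- `loopL1 ≥ 0`. [folklore] -/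
theorem loopL1_nonneg (L : ℕ) (Y : Site d → Fin d → Matrix n n ℂ) (q : Site d) (κ : Fin d) : 0 ≤ loopL1 L Y q κ :=
  Finset.sum_nonneg fun _ _ => mul_nonneg (by positivity) (lnorm_nonneg _ _ _)

/-- `treeL1' ≥ 0`. [folklore] -/
theorem treeL1'_nonneg (L : ℕ) (Y : Site d → Fin d → Matrix n n ℂ) (q : Site d) (κ : Fin d) : 0 ≤ treeL1' L Y q κ :=
  Finset.sum_nonneg fun _ _ => mul_nonneg (by positivity) (lnorm_nonneg _ _ _)

/-- `segL1 ≥ 0`. [folklore] -/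
theorem segL1_nonneg (L : ℕ) (Y : Site d → Fin d → Matrix n n ℂ) (q : Site d) (κ : Fin d) : 0 ≤ segL1 L Y q κ :=
  Finset.sum_nonneg fun _ _ => mul_nonneg (by positivity) (lnorm_nonneg _ _ _)

section Curved

variable [Nonempty n]

omit [Nonempty n] in
/-- **THE MAIN TERM IS BOUNDED BY THE STRAIGHT SEGMENTS**: `‖S(c)‖ ≤ Σ_x L^{−d} Σ_{i<L} ‖Y(x + ie_κ, κ)‖` on `U(N)` data
(`Ad` is isometric, `norm_dhol_le`). [folklore] -/
theorem norm_segMain_le (L : ℕ) {W : Site d → Fin d → (Matrix n n ℂ)ˣ} (hW : IsUnitaryCfg W) (Y : Site d → Fin d → Matrix n n ℂ)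
    (q : Site d) (κ : Fin d) : ‖segMain L W Y q κ‖ ≤ segL1 L Y q κ := by
  unfold segMain segL1
  refine (norm_sum_le _ _).trans (Finset.sum_le_sum fun r _ => ?_)
  rw [norm_smul, norm_inv, norm_pow, Real.norm_natCast, norm_Ad_of_unitary (hol_mem_of hW _ _)]
  exact mul_le_mul_of_nonneg_left (norm_dhol_le hW Y _ _) (by positivity)

/-- **THE STRUCTURE OF `dbarLin` AT A CURVED BACKGROUND.**  On `U(N)` data whose loop variables at `c` are within
`w ≤ 1∕32` of `1`:  `‖dbarLin L W Y c − Ad_{V̄(c)⁻¹} S(c)‖ ≤ w · (1250·(loopL1 + ℓ_Γ) + 8·treeL1′ + 2·ℓ_Γ)`, `ℓ_Γ = Σ_{b⊂Γ_c}‖Y(b)‖`.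
(The frames `F(c₋)`, `F(c₊)` of `BlockAveragePushDirSplit.frameLin` cancel the tree pieces of §1 up to the transports
`Ad_{V̄⁻¹ W_{c,x} W(Γ_c)} = Ad_{1 + O(w)}`; the reversed `Γ_c` pieces cancel `δ(Γ_c)` up to `Ad_{W_{c,x}} = Ad_{1+O(w)}`; the dressing
`δV̄ − δV̄_lin` is row NE3-R2's `norm_sideDeriv_sub_lin_le`.) [folklore] -/
theorem norm_dbarLin_sub_main_le (L : ℕ) (hL : 1 ≤ L) {W : Site d → Fin d → (Matrix n n ℂ)ˣ} (hW : IsUnitaryCfg W)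
    (Y : Site d → Fin d → Matrix n n ℂ) (q : Site d) (κ : Fin d) {w : ℝ} (hw : w ≤ 1 / 32)
    (hWcx : ∀ r : Fin d → Fin L, ‖((Wcx L W q κ (boxVec L r) : (Matrix n n ℂ)ˣ) : Matrix n n ℂ) - 1‖ ≤ w) :
    ‖dbarLin L W Y q κ - Ad (bavg L W q κ)⁻¹ (segMain L W Y q κ)‖
      ≤ w * (1250 * (loopL1 L Y q κ + lnorm Y q (seg κ L)) + 8 * treeL1' L Y q κ + 2 * lnorm Y q (seg κ L)) := by
  letI : CStarAlgebra (Matrix n n ℂ) := {}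
  have hw0 : 0 ≤ w := (norm_nonneg _).trans (hWcx fun _ => ⟨0, hL⟩)
  have hW4 : ∀ r : Fin d → Fin L, ‖((Wcx L W q κ (boxVec L r) : (Matrix n n ℂ)ˣ) : Matrix n n ℂ) - 1‖ ≤ 1 / 4 :=
    fun r => (hWcx r).trans (hw.trans (by norm_num))
  -- names
  set B : (Matrix n n ℂ)ˣ := bavg L W q κ with hB
  set H : (Matrix n n ℂ)ˣ := hol W q (seg κ L) with hH
  set X : Matrix n n ℂ := Xavg L W q κ with hX
  set q' : Site d := q + (L : ℤ) • e κ with hq'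
  set Fq : Matrix n n ℂ := frameLin L W Y q with hFq
  set Fq' : Matrix n n ℂ := frameLin L W Y q' with hFq'
  set S : Matrix n n ℂ := segMain L W Y q κ with hS
  set D : Matrix n n ℂ := dhol W Y q (seg κ L) with hD
  -- unitarity
  have hHu : H ∈ unitaryUnits (Matrix n n ℂ) := hol_mem_of hW _ _
  have hWu : ∀ r : Fin d → Fin L, Wcx L W q κ (boxVec L r) ∈ unitaryUnits (Matrix n n ℂ) := fun r =>
    (unitaryUnits _).mul_mem (hol_mem_of hW _ _) ((unitaryUnits _).inv_mem (hol_mem_of hW _ _))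
  have hEu : expUnit X ∈ unitaryUnits (Matrix n n ℂ) := expUnit_Xavg_mem_unitary L hW q κ hW4
  have hBu : B ∈ unitaryUnits (Matrix n n ℂ) := bavg_mem_unitaryUnits (V := W) hW L q κ hW4
  have hBval : B = expUnit X * H := by apply Units.ext; simp [hB, hX, hH, bavg]
  -- `‖e^{-X} W_{c,x} − 1‖ ≤ 4w`
  have hXn : ‖X‖ ≤ 2 * w := norm_Xavg_le L hL W q κ (hw.trans (by norm_num)) hWcx
  have hU : ∀ r : Fin d → Fin L,
      ‖(((B⁻¹ * (Wcx L W q κ (boxVec L r) * H) : (Matrix n n ℂ)ˣ)) : Matrix n n ℂ) - 1‖ ≤ 4 * w := by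
    intro r
    have e1 : B⁻¹ * (Wcx L W q κ (boxVec L r) * H) = H⁻¹ * ((expUnit X)⁻¹ * Wcx L W q κ (boxVec L r)) * H := by
      rw [hBval]; group
    rw [e1, Units.val_mul, Units.val_mul]
    refine (norm_units_inv_conj_sub_one_le (AveragingDeficitTransport.mem_U1_of_unitary hHu) _).trans ?_
    rw [Units.val_mul, val_inv_expUnit, val_expUnit]
    -- `e^{-X} V − 1 = (e^{-X} − 1) V + (V − 1)`
    have e2 : exp (-X) * ((Wcx L W q κ (boxVec L r) : (Matrix n n ℂ)ˣ) : Matrix n n ℂ) - 1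
        = (exp (-X) - 1) * ((Wcx L W q κ (boxVec L r) : (Matrix n n ℂ)ˣ) : Matrix n n ℂ)
          + (((Wcx L W q κ (boxVec L r) : (Matrix n n ℂ)ˣ) : Matrix n n ℂ) - 1) := by noncomm_ring
    rw [e2]
    have hV1 : ‖((Wcx L W q κ (boxVec L r) : (Matrix n n ℂ)ˣ) : Matrix n n ℂ)‖ = 1 := CStarRing.norm_of_mem_unitary (hWu r)
    have hex : ‖exp (-X) - 1‖ ≤ Real.exp (2 * w) - 1 :=
      (norm_exp_sub_one_le_of_norm_le (by rw [norm_neg]; exact hXn)).1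
    have hex' : Real.exp (2 * w) - 1 ≤ 3 * w := by
      have h := Real.abs_exp_sub_one_sub_id_le (x := 2 * w) (by rw [abs_of_nonneg (by linarith)]; linarith)
      have h2 := (abs_le.mp h).2
      nlinarith
    calc _ ≤ ‖(exp (-X) - 1) * ((Wcx L W q κ (boxVec L r) : (Matrix n n ℂ)ˣ) : Matrix n n ℂ)‖
            + ‖((Wcx L W q κ (boxVec L r) : (Matrix n n ℂ)ˣ) : Matrix n n ℂ) - 1‖ := norm_add_le _ _
      _ ≤ ‖exp (-X) - 1‖ * ‖((Wcx L W q κ (boxVec L r) : (Matrix n n ℂ)ˣ) : Matrix n n ℂ)‖ + w :=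
            add_le_add (norm_mul_le _ _) (hWcx r)
      _ ≤ (3 * w) * 1 + w := by rw [hV1]; gcongr; exact hex.trans hex'
      _ = 4 * w := by ring
  -- (i) the dressing error `Ad_{B⁻¹}(δV̄ − δV̄_lin)`
  obtain ⟨hlin, -⟩ := norm_sideDeriv_sub_lin_le L hL hW Y q κ hw hWcx
  have hloopAvg : loopAvg L W Y q κ ≤ loopL1 L Y q κ := by
    unfold loopAvg loopL1
    exact Finset.sum_le_sum fun r _ => mul_le_mul_of_nonneg_left (norm_dhol_le hW Y _ _) (by positivity)
  have hDn : ‖D‖ ≤ lnorm Y q (seg κ L) := norm_dhol_le hW Y _ _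
  -- (ii) the algebra: `δV̄_lin = F(c₋) + S − T₁ − T₂ + D`
  set T1 : Matrix n n ℂ := ∑ r : Fin d → Fin L, (((L : ℝ) ^ d)⁻¹) •
      Ad (Wcx L W q κ (boxVec L r) * H) (dhol W Y q' (treeWord (boxVec L r))) with hT1
  set T2 : Matrix n n ℂ := ∑ r : Fin d → Fin L, (((L : ℝ) ^ d)⁻¹) • Ad (Wcx L W q κ (boxVec L r)) D with hT2
  have hsplit : sideDerivLin L W Y q κ = Fq + S - T1 - T2 + D := by
    simp only [sideDerivLin, hFq, frameLin, hS, segMain, hD, hH, hq', hT1, hT2, dhol_loopWord, smul_add, smul_sub,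
      Finset.sum_add_distrib, Finset.sum_sub_distrib]
  -- (iii) assemble `dbarLin − Ad_{B⁻¹} S`
  have hdbar : dbarLin L W Y q κ - Ad B⁻¹ S
      = Ad B⁻¹ (sideDeriv L W Y q κ - sideDerivLin L W Y q κ) + (Fq' - Ad B⁻¹ T1) + Ad B⁻¹ (D - T2) := by
    have e0 : dbarLin L W Y q κ = Ad B⁻¹ (sideDeriv L W Y q κ) - (Ad B⁻¹ Fq - Fq') := rfl
    have e1 : sideDeriv L W Y q κ = (sideDeriv L W Y q κ - sideDerivLin L W Y q κ) + sideDerivLin L W Y q κ := by abel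
    rw [e0, e1, hsplit]
    simp only [Ad_add, Ad_sub]
    abel
  -- (iv) the three error bounds
  have hE1 : ‖Ad B⁻¹ (sideDeriv L W Y q κ - sideDerivLin L W Y q κ)‖
      ≤ 1250 * w * (loopL1 L Y q κ + lnorm Y q (seg κ L)) := by
    rw [norm_Ad_of_unitary ((unitaryUnits _).inv_mem hBu)]
    refine hlin.trans ?_
    have : 0 ≤ 1250 * w := by positivity
    exact mul_le_mul_of_nonneg_left (add_le_add hloopAvg hDn) this
  have hE2 : ‖Fq' - Ad B⁻¹ T1‖ ≤ 8 * w * treeL1' L Y q κ := by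
    have e1 : Fq' - Ad B⁻¹ T1
        = ∑ r : Fin d → Fin L, (((L : ℝ) ^ d)⁻¹) • (dhol W Y q' (treeWord (boxVec L r))
            - Ad (B⁻¹ * (Wcx L W q κ (boxVec L r) * H)) (dhol W Y q' (treeWord (boxVec L r)))) := by
      have hAdsmul : ∀ (u : (Matrix n n ℂ)ˣ) (c : ℝ) (Z : Matrix n n ℂ), Ad u (c • Z) = c • Ad u Z :=
        fun u c Z => by simp only [Ad, smul_mul_assoc, mul_smul_comm]
      simp only [hFq', frameLin, hT1, Ad_sum, hAdsmul, ← Ad_mul, smul_sub, Finset.sum_sub_distrib]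
    rw [e1, treeL1', Finset.mul_sum]
    refine (norm_sum_le _ _).trans (Finset.sum_le_sum fun r _ => ?_)
    rw [norm_smul, norm_inv, norm_pow, Real.norm_natCast, norm_sub_rev]
    have hu : B⁻¹ * (Wcx L W q κ (boxVec L r) * H) ∈ unitaryUnits (Matrix n n ℂ) :=
      (unitaryUnits _).mul_mem ((unitaryUnits _).inv_mem hBu) ((unitaryUnits _).mul_mem (hWu r) hHu)
    have h := norm_Ad_sub_le hu (dhol W Y q' (treeWord (boxVec L r)))
    have hZ : ‖dhol W Y q' (treeWord (boxVec L r))‖ ≤ lnorm Y q' (treeWord (boxVec L r)) := norm_dhol_le hW Y _ _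
    calc ((L : ℝ) ^ d)⁻¹ * ‖Ad (B⁻¹ * (Wcx L W q κ (boxVec L r) * H)) (dhol W Y q' (treeWord (boxVec L r)))
            - dhol W Y q' (treeWord (boxVec L r))‖
        ≤ ((L : ℝ) ^ d)⁻¹ * (2 * (4 * w) * lnorm Y q' (treeWord (boxVec L r))) := by
          refine mul_le_mul_of_nonneg_left (h.trans ?_) (by positivity)
          have := hU r
          gcongr
      _ = 8 * w * (((L : ℝ) ^ d)⁻¹ * lnorm Y (q + (L : ℤ) • e κ) (treeWord (boxVec L r))) := by rw [hq']; ring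
  have hE3 : ‖Ad B⁻¹ (D - T2)‖ ≤ 2 * w * lnorm Y q (seg κ L) := by
    have hDsum : D - T2 = ∑ r : Fin d → Fin L, (((L : ℝ) ^ d)⁻¹) • (D - Ad (Wcx L W q κ (boxVec L r)) D) := by
      rw [hT2]
      simp only [smul_sub, Finset.sum_sub_distrib]
      rw [← Finset.sum_smul, BlockAveragePushDirSplit.sum_blockWeight_eq_one L hL, one_smul]
    rw [norm_Ad_of_unitary ((unitaryUnits _).inv_mem hBu), hDsum]
    refine (norm_sum_le _ _).trans ?_
    calc ∑ r : Fin d → Fin L, ‖(((L : ℝ) ^ d)⁻¹) • (D - Ad (Wcx L W q κ (boxVec L r)) D)‖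
        ≤ ∑ _r : Fin d → Fin L, ((L : ℝ) ^ d)⁻¹ * (2 * w * lnorm Y q (seg κ L)) := by
          refine Finset.sum_le_sum fun r _ => ?_
          rw [norm_smul, norm_inv, norm_pow, Real.norm_natCast, norm_sub_rev]
          refine mul_le_mul_of_nonneg_left ((norm_Ad_sub_le (hWu r) D).trans ?_) (by positivity)
          have := hWcx r
          gcongr
      _ = 2 * w * lnorm Y q (seg κ L) := by rw [← Finset.sum_mul, BlockAveragePushDirSplit.sum_blockWeight_eq_one L hL, one_mul]
  -- (v) conclude
  rw [hdbar]
  calc _ ≤ ‖Ad B⁻¹ (sideDeriv L W Y q κ - sideDerivLin L W Y q κ) + (Fq' - Ad B⁻¹ T1)‖ + ‖Ad B⁻¹ (D - T2)‖ :=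
        norm_add_le _ _
    _ ≤ (1250 * w * (loopL1 L Y q κ + lnorm Y q (seg κ L)) + 8 * w * treeL1' L Y q κ) + 2 * w * lnorm Y q (seg κ L) :=
        add_le_add ((norm_add_le _ _).trans (add_le_add hE1 hE2)) hE3
    _ = w * (1250 * (loopL1 L Y q κ + lnorm Y q (seg κ L)) + 8 * treeL1' L Y q κ + 2 * lnorm Y q (seg κ L)) := by ring

/-- **`dbarLin` POINTWISE**: `‖dbarLin c‖ ≤ segL1 + w·(1250·(loopL1 + ℓ_Γ) + 8·treeL1′ + 2·ℓ_Γ)`. [folklore] -/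
theorem norm_dbarLin_le (L : ℕ) (hL : 1 ≤ L) {W : Site d → Fin d → (Matrix n n ℂ)ˣ} (hW : IsUnitaryCfg W)
    (Y : Site d → Fin d → Matrix n n ℂ) (q : Site d) (κ : Fin d) {w : ℝ} (hw : w ≤ 1 / 32)
    (hWcx : ∀ r : Fin d → Fin L, ‖((Wcx L W q κ (boxVec L r) : (Matrix n n ℂ)ˣ) : Matrix n n ℂ) - 1‖ ≤ w) :
    ‖dbarLin L W Y q κ‖
      ≤ segL1 L Y q κ + w * (1250 * (loopL1 L Y q κ + lnorm Y q (seg κ L)) + 8 * treeL1' L Y q κ + 2 * lnorm Y q (seg κ L)) := by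
  letI : CStarAlgebra (Matrix n n ℂ) := {}
  have hW4 : ∀ r : Fin d → Fin L, ‖((Wcx L W q κ (boxVec L r) : (Matrix n n ℂ)ˣ) : Matrix n n ℂ) - 1‖ ≤ 1 / 4 :=
    fun r => (hWcx r).trans (hw.trans (by norm_num))
  have hBu : bavg L W q κ ∈ unitaryUnits (Matrix n n ℂ) := bavg_mem_unitaryUnits (V := W) hW L q κ hW4
  have h1 := norm_dbarLin_sub_main_le L hL hW Y q κ hw hWcx
  have h2 : ‖Ad (bavg L W q κ)⁻¹ (segMain L W Y q κ)‖ ≤ segL1 L Y q κ := by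
    rw [norm_Ad_of_unitary ((unitaryUnits _).inv_mem hBu)]
    exact norm_segMain_le L hW Y q κ
  calc ‖dbarLin L W Y q κ‖ = ‖Ad (bavg L W q κ)⁻¹ (segMain L W Y q κ)
        + (dbarLin L W Y q κ - Ad (bavg L W q κ)⁻¹ (segMain L W Y q κ))‖ := by rw [add_sub_cancel]
    _ ≤ _ := norm_add_le _ _
    _ ≤ _ := add_le_add h2 h1

end Curved

end

end Summit.QuantumFields.BalabanUV.T4Continuum.BlockAverageDbarLinBound
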